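import Literature.MathematicalPhysics.QuantumFieldTheory.Balaban1983to89.B9Eq3117Current
import Literature.MathematicalPhysics.QuantumFieldTheory.Balaban1983to89.LatticeFieldCalculus

/-!
# `Balaban1983to89.B9TorusCalculus` — the exact-background lattice calculus of B9 (3.1)–(3.12), (3.28)–(3.30), (3.117)
ON THE TORI OF RECORD `Site P j` of `Setup` (v2: + the second identity of (3.117), (3.120), (3.30) operator form)

HONEST FRAMING (cell `lit-balaban`, verbatim): statement-level skeleton of published theorems with citation tags; proofs
where landed; nothing here is a claim about the Yang–Mills mass gap.

CITATION HEADER. T. Bałaban, *Propagators for lattice gauge theories in a background field*, Commun. Math. Phys. **99**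
(1985) 389–434 [`Balaban1985BackgroundPropagators`] (= B9), §A p. 390: «Let us consider gauge field configurations `U`
defined on a lattice `T`, e.g., `T_η` with the lattice spacing `η`» — all of (3.1)–(3.12) is local lattice calculus on a
periodic lattice.  The kernel-checked B9 modules `B9Eq37Insertion` → `B9Eq39Adjoint` → `B9Eq310Hermitian`/`B9Eq370Expansion`
→ `B9Eq352ScalarFluct`/`B9Eq3117Current`/`B9AppChiral` ("pv27 vocabulary") work on an ABSTRACT finite lattice: sites `S`,
directions `ι`, shifts `T : ι → Equiv.Perm S`, with the one geometric hypothesis `hT : ∀ μ ν x, T μ (T ν x) = T ν (T μ x)`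
(plaquettes close) wherever a plaquette variable is conjugated or a double divergence telescopes.  The series' carriers OF
RECORD are the tori `Site P j = Fin P.d → ZMod (P.sitesPerDir j)` of `Setup` with the translations `Site.shift`, packaged
as permutations `LatticeFieldCalculus.shiftEquiv`.  THIS FILE is the dictionary: it instantiates `S := Site P j`, `ι := Fin P.d`,
`T := shiftEquiv`, PROVES `hT` once (`torusT_comm`), identifies the flat covariant derivative with the linear calculus of
`LatticeFieldCalculus` (`covD_one`, `covD_one_eq_pdiff`), and re-exports the headline exact identities free of `hT`:
D*J = 0 (3.117), gauge invariance of the Wilson action (3.29), covariance of the current and of `⟨A,Δ^η(U)A⟩` (3.30);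
v2 (§4): the second identity of (3.117) (`eq3117_quadShift`, from the discharged fact `B9Eq3117Current.Eq3117QuadShift`), its
corollary (3.120) (`eq3120`) and the operator form of (3.30) for `B9Eq310Hermitian.deltaOp` (`deltaOp_gaugeTr`), all with the
torus antecedent discharged.

WHAT THIS FILE PROVIDES. Definitions with bodies and theorems only; no `Prop` placeholders; standard axioms (v2 requires
`B9Eq3117Current` v3, tree commit d843affdfd0d).
-/

namespace Literature.MathematicalPhysics.QuantumFieldTheory.Balaban1983to89.B9TorusCalculus

open Literature.MathematicalPhysics.QuantumFieldTheory.Balaban1983to89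
open Literature.MathematicalPhysics.QuantumFieldTheory.Balaban1983to89.B9Eq37Insertion
open Literature.MathematicalPhysics.QuantumFieldTheory.Balaban1983to89.B9Eq39Adjoint
open Literature.MathematicalPhysics.QuantumFieldTheory.Balaban1983to89.B9Eq3117Current

/-! ## §1  The shifts of the torus `T^{(j)}` as the pv27 datum `T : ι → Equiv.Perm S`, and the closing of plaquettes -/

section Shifts

variable {P : Params} {j : ℕ}

/-- The pv27 shift datum of the torus `T^{(j)}`: `T μ = (x ↦ x + e_μ)` as a permutation of `Site P j`
(`LatticeFieldCalculus.shiftEquiv`). [folklore] [cite: Balaban1985BackgroundPropagators, (3.1) p.390] -/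
def torusT (P : Params) (j : ℕ) : Fin P.d → Equiv.Perm (Site P j) := fun μ => LatticeFieldCalculus.shiftEquiv μ

/-- Unfolding: `torusT μ x = x + e_μ`. [folklore] [cite: Balaban1985BackgroundPropagators, (3.1) p.390] -/
@[simp] theorem torusT_apply (μ : Fin P.d) (x : Site P j) : torusT P j μ x = x.shift μ := rfl

/-- Unfolding the inverse: `(torusT μ)⁻¹ x = x − e_μ`. [folklore] [cite: Balaban1985BackgroundPropagators, (3.8) p.392] -/
@[simp] theorem torusT_symm_apply (μ : Fin P.d) (x : Site P j) : (torusT P j μ).symm x = x.unshift μ := rfl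

/-- **Plaquettes close on the torus**: `(x + e_μ) + e_ν = (x + e_ν) + e_μ` — the hypothesis `hT` of every pv27 statement that
conjugates a plaquette variable or telescopes a double divergence, discharged once and for all for the tori of record.
[folklore] [cite: Balaban1985BackgroundPropagators, (3.2) p.390] -/
theorem torusT_comm (μ ν : Fin P.d) (x : Site P j) : torusT P j μ (torusT P j ν x) = torusT P j ν (torusT P j μ x) := by
  simp only [torusT_apply]
  funext κ
  simp only [Site.shift, Function.update_apply]
  split_ifs with h₁ h₂ <;> subst_vars <;> simp_all

end Shifts

/-! ## §2  The flat case `U ≡ 1`: the covariant derivative (3.8) IS the forward difference of `LatticeFieldCalculus` -/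

section Flat

variable {P : Params} {j : ℕ} {𝔸 : Type*} [Ring 𝔸]

/-- At the trivial background the covariant derivative (3.8) is the plain forward difference:
`(D_{1,μ} f)(x) = f(x + e_μ) − f(x)`. [folklore] [cite: Balaban1985BackgroundPropagators, (3.8) p.392] -/
theorem covD_one (μ : Fin P.d) (f : Site P j → 𝔸) (x : Site P j) :
    covD (torusT P j) (fun _ _ => (1 : 𝔸ˣ)) μ f x = f (x.shift μ) - f x := by
  simp [covD]

/-- … and the adjoint (3.8) is the backward difference: `(D*_{1,μ} G)(x) = G(x − e_μ) − G(x)`. [folklore]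
[cite: Balaban1985BackgroundPropagators, (3.8) p.392] -/
theorem covDstar_one (μ : Fin P.d) (G : Site P j → 𝔸) (x : Site P j) :
    covDstar (torusT P j) (fun _ _ => (1 : 𝔸ˣ)) μ G x = G (x.unshift μ) - G x := by
  simp [covDstar]

/-- Dictionary with the linear calculus of record: at `U ≡ 1` and unit prefactor, B9's `D_{U,μ}` (3.8) is
`LatticeFieldCalculus.pdiff 1 μ` ([Balaban1984PropagatorsI] (1.2)). [folklore] [cite: Balaban1985BackgroundPropagators, (3.8) p.392] -/
theorem covD_one_eq_pdiff [Module ℝ 𝔸] (μ : Fin P.d) (f : Site P j → 𝔸) (x : Site P j) :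
    covD (torusT P j) (fun _ _ => (1 : 𝔸ˣ)) μ f x = LatticeFieldCalculus.pdiff 1 μ f x := by
  rw [covD_one, LatticeFieldCalculus.pdiff, one_smul]

/-- Same for the adjoint: `D*_{1,μ} = LatticeFieldCalculus.pdiffAdj 1 μ` ([Balaban1984PropagatorsI] (1.21)). [folklore]
[cite: Balaban1985BackgroundPropagators, (3.8) p.392] -/
theorem covDstar_one_eq_pdiffAdj [Module ℝ 𝔸] (μ : Fin P.d) (G : Site P j → 𝔸) (x : Site P j) :
    covDstar (torusT P j) (fun _ _ => (1 : 𝔸ˣ)) μ G x = LatticeFieldCalculus.pdiffAdj 1 μ G x := by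
  rw [covDstar_one, LatticeFieldCalculus.pdiffAdj, one_smul]

end Flat

/-! ## §3  The headline exact identities of B9 §A on the tori of record, free of the hypothesis `hT` -/

section Headline

variable {P : Params} {j : ℕ}
variable {𝔸 : Type*} [Ring 𝔸] [Algebra ℂ 𝔸]

/-- **(3.117), first identity, on `T^{(j)}`: `D*J = 0`** for the current `J = D*(η⁻² Im ∂U)` of (3.11), for EVERY background
`U` of units on the torus (`B9Eq3117Current.divB_J_eq_zero` with `hT := torusT_comm`). [folklore]
[cite: Balaban1985BackgroundPropagators, (3.117) p.419, (3.11) p.392] -/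
theorem divB_J_eq_zero (U : Fin P.d → Site P j → 𝔸ˣ) (η : ℝ) (x : Site P j) :
    divB (torusT P j) U (J (torusT P j) U η) x = 0 :=
  B9Eq3117Current.divB_J_eq_zero (torusT P j) U (torusT_comm) η x

/-- **(3.30) on `T^{(j)}`: `J^u = R(u)J`.** [folklore] [cite: Balaban1985BackgroundPropagators, (3.30) p.395] -/
theorem J_gaugeTr (U : Fin P.d → Site P j → 𝔸ˣ) (u : Site P j → 𝔸ˣ) (η : ℝ) (μ : Fin P.d) (x : Site P j) :
    J (torusT P j) (gaugeTr (torusT P j) u U) η μ x = R (u x) (J (torusT P j) U η μ x) :=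
  B9Eq3117Current.J_gaugeTr (torusT P j) U torusT_comm u η μ x

end Headline

section HeadlineNormed

variable {P : Params} {j : ℕ}
variable {𝔸 : Type*} [NormedRing 𝔸] [NormedAlgebra ℂ 𝔸]

/-- **(3.29) on `T^{(j)}`: the Wilson action is gauge invariant, `A^η(U^u) = A^η(U)`**, for every tracial `τ`. [folklore]
[cite: Balaban1985BackgroundPropagators, (3.29) p.395] -/
theorem action_gaugeTr (U : Fin P.d → Site P j → 𝔸ˣ) (τ : 𝔸 →ₗ[ℂ] ℂ) (hτ : ∀ a b : 𝔸, τ (a * b) = τ (b * a))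
    (η : ℝ) (d : ℕ) (u : Site P j → 𝔸ˣ) :
    action (torusT P j) η d τ (gaugeTr (torusT P j) u U) = action (torusT P j) η d τ U :=
  B9Eq3117Current.action_gaugeTr (torusT P j) U torusT_comm τ hτ η d u

/-- **(3.30) on `T^{(j)}`: `⟨R(u)A, Δ^η(U^u)R(u)A⟩ = ⟨A, Δ^η(U)A⟩`.** [folklore] [cite: Balaban1985BackgroundPropagators, (3.30) p.395] -/
theorem hessPair_gaugeTr (U : Fin P.d → Site P j → 𝔸ˣ) (τ : 𝔸 →ₗ[ℂ] ℂ) (hτ : ∀ a b : 𝔸, τ (a * b) = τ (b * a))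
    (η : ℝ) (d : ℕ) (u : Site P j → 𝔸ˣ) (A : Fin P.d → Site P j → 𝔸) :
    hessPair (torusT P j) (gaugeTr (torusT P j) u U) η d τ (rotB u A) = hessPair (torusT P j) U η d τ A :=
  B9Eq3117Current.hessPair_gaugeTr (torusT P j) U torusT_comm τ hτ η d u A

/-- **⟨Dλ, J⟩ = 0 on `T^{(j)}`** (the dual form of D*J = 0 used in (3.117)). [folklore]
[cite: Balaban1985BackgroundPropagators, (3.117) p.419] -/
theorem bondPair_covDη_J (U : Fin P.d → Site P j → 𝔸ˣ) (τ : 𝔸 →ₗ[ℂ] ℂ)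
    (hτ : ∀ a b : 𝔸, τ (a * b) = τ (b * a)) (η : ℝ) (d : ℕ) (lam : Site P j → 𝔸) :
    bondPair η d τ (covDη (torusT P j) U η lam) (J (torusT P j) U η) = 0 :=
  B9Eq3117Current.bondPair_covDη_J (torusT P j) U torusT_comm τ hτ η d lam

end HeadlineNormed

/-! ## §4  (v2) The second identity of (3.117), its corollary (3.120), and the operator form of (3.30) on the tori of record -/

section SecondIdentity

variable {P : Params} {j : ℕ}
variable {𝔸 : Type*} [NormedRing 𝔸] [NormedAlgebra ℂ 𝔸] [CompleteSpace 𝔸]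

/-- **(3.117), second identity, on `T^{(j)}`** — the named fact `B9Eq3117Current.Eq3117QuadShift` specialised to the torus: its
torus antecedent is discharged by `torusT_comm`, leaving the printed standing hypotheses «tr tracial» and `η ≠ 0`. [folklore]
[cite: Balaban1985BackgroundPropagators, (3.117) p.419] -/
theorem eq3117_quadShift (U : Fin P.d → Site P j → 𝔸ˣ) (τ : 𝔸 →L[ℂ] ℂ) (hτ : ∀ a b : 𝔸, τ (a * b) = τ (b * a))
    {η : ℝ} (hη : η ≠ 0) (d : ℕ) (A : Fin P.d → Site P j → 𝔸) (lam : Site P j → 𝔸) :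
    hessPair (torusT P j) U η d (τ : 𝔸 →ₗ[ℂ] ℂ) (fun μ x => A μ x - covDη (torusT P j) U η lam μ x)
      = hessPair (torusT P j) U η d (τ : 𝔸 →ₗ[ℂ] ℂ) A
        - bondPair η d (τ : 𝔸 →ₗ[ℂ] ℂ) (shiftJ (torusT P j) U η lam A) (J (torusT P j) U η) :=
  B9Eq3117Current.Eq3117QuadShift_holds (torusT P j) U η d τ torusT_comm hτ hη A lam

/-- **(3.120) on `T^{(j)}`**: `⟨A,Δ_πA⟩ = ⟨A,ΔA⟩ − ⟨A,Δ′_πA⟩` for every `P` (print `P = G′RD*`). [folklore]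
[cite: Balaban1985BackgroundPropagators, (3.120) p.419] -/
theorem eq3120 (U : Fin P.d → Site P j → 𝔸ˣ) (τ : 𝔸 →L[ℂ] ℂ) (hτ : ∀ a b : 𝔸, τ (a * b) = τ (b * a))
    {η : ℝ} (hη : η ≠ 0) (d : ℕ) (Pop : (Fin P.d → Site P j → 𝔸) → Site P j → 𝔸) (A : Fin P.d → Site P j → 𝔸) :
    hessPi (torusT P j) U η d (τ : 𝔸 →ₗ[ℂ] ℂ) Pop A
      = hessPair (torusT P j) U η d (τ : 𝔸 →ₗ[ℂ] ℂ) A - deltaPiPrime (torusT P j) U η d (τ : 𝔸 →ₗ[ℂ] ℂ) Pop A :=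
  B9Eq3117Current.eq3120 (torusT P j) U torusT_comm τ hτ hη d Pop A

end SecondIdentity

section Operator

variable {P : Params} {j : ℕ}
variable {𝔸 : Type*} [Ring 𝔸] [Algebra ℂ 𝔸]

/-- **(3.30), operator form, on `T^{(j)}`: `Δ^η(U^u)(R(u)A) = R(u)(Δ^η(U)A)`** for `B9Eq310Hermitian.deltaOp`. [folklore]
[cite: Balaban1985BackgroundPropagators, (3.30) p.395] -/
theorem deltaOp_gaugeTr (U : Fin P.d → Site P j → 𝔸ˣ) (u : Site P j → 𝔸ˣ) (η : ℝ) (A : Fin P.d → Site P j → 𝔸)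
    (μ : Fin P.d) (x : Site P j) :
    B9Eq310Hermitian.deltaOp (torusT P j) (gaugeTr (torusT P j) u U) η (rotB u A) μ x
      = R (u x) (B9Eq310Hermitian.deltaOp (torusT P j) U η A μ x) :=
  B9Eq3117Current.deltaOp_gaugeTr (torusT P j) U torusT_comm u η A μ x

end Operator

end Literature.MathematicalPhysics.QuantumFieldTheory.Balaban1983to89.B9TorusCalculus
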